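import Mathlib
import Literature.Analysis.FluidPDE.LocalTypeI
import Literature.Analysis.FluidPDE.SelfSimilar
import Literature.Analysis.FluidPDE.ScalingUniformRecurrence
import Literature.Analysis.FluidPDE.ClassicalSolution
import Literature.Analysis.FluidPDE.Vorticity
import Literature.Analysis.FluidPDE.LerayGaugeStrainSpectrum
import Literature.Analysis.FluidPDE.NSWave0
import HarnessLib

/-!
# Sketch — crux-ideate `stmt-NavierStokesRegularity-1589` (RecurrentLiouville), round 2, ideator 4

First lemmas of the crux idea card `flux-weighted-stretching-clock`
(file `idea-flux-weighted-stretching-clock.md`): the WINDOWED and the ADJOINT-FLUX-WEIGHTED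
stretching laws on recurrent Type-I hulls ("cumulative stretching must keep the logarithmic clock";
averaged Must-Squeeze via the adjoint of the vorticity / induction equation).
They need not be proved here; they must elaborate (`lean check` rc 0, no `sorry`).

Notation (original variables, time first): `u : ℝ → ℝ³ → ℝ³`, `ω = vorticity u`,
`λ₁(t,x) = topStrain u t x` = largest principal strain of `∇u(t,x)` (tree `strainEigenvalues`,
decreasing enumeration, index `0`), adjoint test fields `η : ℝ → ℝ³ → ℝ³` solving
`−∂ₜη = Δη + (u·∇)η + (∇u)ᵀη` on a window `[t₀, t₁] ⊂ (−∞, 0)`.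
-/

namespace Summit.NavierStokesRegularity.NavierStokesRegularity.Cruxes.RecurrentLiouville.StretchingClock

open MeasureTheory Set Filter
open scoped ENNReal Topology RealInnerProductSpace Laplacian

open Literature.Analysis.FluidPDE

/-- Local notation for physical space. -/
local notation "E3" => EuclideanSpace ℝ (Fin 3)

/-- The crux's Albritton–Barker Type-I class (letter for letter the four class hypotheses of
`SqueezeCycle.RecurrentLiouville` / `RecurrentProfiles.RecurrentLiouville`). -/
def InCruxClass (C : ℝ) (u : ℝ → E3 → E3) (p : ℝ → E3 → ℝ)
    (G : ℝ → E3 → E3 →L[ℝ] E3) : Prop :=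
  IsSuitableWeakSolutionOn (slab E3 (Iio 0) isOpen_Iio) 1 0 u p ∧
    HasWeakSpatialGradientOn (slab E3 (Iio 0) isOpen_Iio) u G ∧
    typeIBound (Iio (0 : ℝ) ×ˢ univ) u p G < ⊤ ∧ HasTypeITimeDecay C u

/-- The largest principal strain `λ₁(∇u(t,x))` of the time slice `u t` at `x`
(tree `strainEigenvalues`, decreasing order, index `0`; `(−t)·λ₁` is its Leray gauge). -/
noncomputable def topStrain (u : ℝ → E3 → E3) (t : ℝ) (x : E3) : ℝ :=
  strainEigenvalues (fderiv ℝ (u t) x : E3 →ₗ[ℝ] E3) finrank_euclideanSpace_fin 0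

/-- `η` is a rapidly decaying classical solution of the ADJOINT vorticity (induction) equation
`−∂ₜη = Δη + (u·∇)η + (∇u)ᵀη` along `u` on the time set `S` (the `L²(dx)`-adjoint of
`ω ↦ Δω − (u·∇)ω + (∇u)ω` for divergence-free `u`): the Eulerian density of a material
2-current (vortex-flux test surface) transported BACKWARD by `u` — Helmholtz's theorem in dual
form. -/
def IsAdjointVorticityTestField (S : Set ℝ) (u η : ℝ → E3 → E3) : Prop :=
  IsSmoothSpaceTimeOn S η ∧ (∀ t ∈ S, HasRapidSpatialDecay (η t)) ∧
    ∀ t ∈ S, ∀ x,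
      timeDerivWithin S η t x + (Δ (η t)) x + convect (u t) (η t) x
          + ContinuousLinearMap.adjoint (fderiv ℝ (u t) x) (η t x) = 0

/-- **K1 · ADJOINT PAIRING IDENTITY (Helmholtz duality; provable now, size M).** For a classical
Navier–Stokes solution `(u, q)` (`ν = 1`, `f = 0`) on a compact window `[t₀, t₁]` with bounded
velocity gradient, and an adjoint test field `η` on the window, the flux pairing
`∫ ⟪ω(t,x), η(t,x)⟫ dx` takes the same value at `t₀` and `t₁` (indeed it is constant in `t`):
`d/dt ∫ω·η = ∫(Δω − u·∇ω + (∇u)ω)·η + ∫ω·∂ₜη = ∫ ω·(Δη + u·∇η + (∇u)ᵀη + ∂ₜη) = 0`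
(integration by parts; `div u = 0`; rapid decay of `η` and boundedness of `ω`, `∇u`). -/
def AdjointPairingIdentity : Prop :=
  ∀ (t₀ t₁ : ℝ), t₀ < t₁ → ∀ (u : ℝ → E3 → E3) (q : ℝ → E3 → ℝ) (η : ℝ → E3 → E3),
    IsClassicalNSSolutionOn (Icc t₀ t₁) 1 0 u q →
    (∃ K : ℝ, ∀ t ∈ Icc t₀ t₁, ∀ x, ‖u t x‖ ≤ K ∧ ‖fderiv ℝ (u t) x‖ ≤ K) →
    IsAdjointVorticityTestField (Icc t₀ t₁) u η →
      ∫ x, ⟪vorticity u t₀ x, η t₀ x⟫ = ∫ x, ⟪vorticity u t₁ x, η t₁ x⟫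

/-- **K1′ · ADJOINT MASS INEQUALITY (Kato; provable now, size M).** Along an adjoint test field the
`L¹` mass can grow BACKWARD in time at most at the `|η|`-weighted top strain:
`‖η(t₀)‖₁ ≤ ‖η(t₁)‖₁ + ∫_{t₀}^{t₁} ∫ λ₁(∇u(t,x))⁺‖η(t,x)‖ dx dt`
(`∂_τ|η| ≤ Δ|η| + u·∇|η| + (η̂·Sη̂)|η|`, `τ = t₁ − t`, `η̂·Sη̂ ≤ λ₁`, `div u = 0`). -/
def AdjointMassInequality : Prop :=
  ∀ (t₀ t₁ : ℝ), t₀ < t₁ → ∀ (u : ℝ → E3 → E3) (q : ℝ → E3 → ℝ) (η : ℝ → E3 → E3),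
    IsClassicalNSSolutionOn (Icc t₀ t₁) 1 0 u q →
    (∃ K : ℝ, ∀ t ∈ Icc t₀ t₁, ∀ x, ‖u t x‖ ≤ K ∧ ‖fderiv ℝ (u t) x‖ ≤ K) →
    IsAdjointVorticityTestField (Icc t₀ t₁) u η →
      ∫ x, ‖η t₀ x‖ ≤ (∫ x, ‖η t₁ x‖)
        + ∫ t in t₀..t₁, ∫ x, max (topStrain u t x) 0 * ‖η t x‖

/-- **K2 · WINDOWED STRETCHING-CLOCK LAW (sup form; provable now from the tree's no-slack maximum
principle by NOT discarding the time integral, size M/L).** For every profile of the crux's class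
that is classical on the open past (interior representative), uniformly recurrent under scaling and
singular at the origin, there is a constant `K` (depending on the profile) such that on EVERY
window `t₀ < t₁ < 0` and for every time-dependent majorant `Λ` of the top strain,
`log(t₀/t₁) − K ≤ ∫_{t₀}^{t₁} Λ(t) dt`:
cumulative maximal stretching keeps the logarithmic clock of the self-similar collapse with slope
EXACTLY `1` (= the vorticity dilution rate `2a` of Leray's variables). In log-time `s = −log(−t)`:
the window average of `sup_x (−t)λ₁` is `≥ 1 − K/(s₁ − s₀)`. The landed pointwise floor
`stub_noSlackStretching` (p94840: `sup_{t,x,e} (−t)⟪∇u e,e⟫ ≥ 1`) is its length-zero shadow. -/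
def StretchingClockLaw : Prop :=
  ∀ (C : ℝ) (u : ℝ → E3 → E3) (p : ℝ → E3 → ℝ) (G : ℝ → E3 → E3 →L[ℝ] E3) (q : ℝ → E3 → ℝ),
    InCruxClass C u p G → IsClassicalNSSolutionOn (Iio 0) 1 0 u q →
    IsScalingUniformlyRecurrent u → IsBackwardSingularPoint u 0 →
      ∃ K : ℝ, ∀ (t₀ t₁ : ℝ), t₀ < t₁ → t₁ < 0 → ∀ Λ : ℝ → ℝ,
        (∀ t ∈ Icc t₀ t₁, ∀ x, topStrain u t x ≤ Λ t) → ContinuousOn Λ (Icc t₀ t₁) →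
          Real.log (t₀ / t₁) - K ≤ ∫ t in t₀..t₁, Λ t

/-- **K2′ · STRAIN-ACTIVE EPOCHS HAVE POSITIVE LOG-TIME DENSITY (corollary of K2 and the class
gauge bound `(−t)‖∇u‖ ≤ K₁`; provable now).** With `θ(δ) = δ/(K₁ − 1 + δ)`: on every long window the
set of times at which SOMEWHERE `(−t)λ₁ ≥ 1 − δ` has logarithmic measure at least
`θ(δ)·log(t₀/t₁) − K′`. Stated with an arbitrary measurable indicator majorant to stay junk-free:
if `χ : ℝ → ℝ` dominates the indicator of the active epochs, `∫ χ dt/(−t) ≥ θ log(t₀/t₁) − K′`. -/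
def StrainEpochDensity : Prop :=
  ∀ (C K₁ : ℝ) (u : ℝ → E3 → E3) (p : ℝ → E3 → ℝ) (G : ℝ → E3 → E3 →L[ℝ] E3) (q : ℝ → E3 → ℝ),
    InCruxClass C u p G → IsClassicalNSSolutionOn (Iio 0) 1 0 u q →
    IsScalingUniformlyRecurrent u → IsBackwardSingularPoint u 0 →
    (∀ t < 0, ∀ x, (-t) * ‖fderiv ℝ (u t) x‖ ≤ K₁) →
      ∀ δ : ℝ, 0 < δ → δ < 1 → ∃ K' : ℝ, ∀ (t₀ t₁ : ℝ), t₀ < t₁ → t₁ < 0 → ∀ χ : ℝ → ℝ,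
        ContinuousOn χ (Icc t₀ t₁) → (∀ t, 0 ≤ χ t) →
        (∀ t ∈ Icc t₀ t₁, (∃ x, 1 - δ ≤ (-t) * topStrain u t x) → 1 ≤ χ t) →
          δ / (K₁ - 1 + δ) * Real.log (t₀ / t₁) - K' ≤ ∫ t in t₀..t₁, χ t / (-t)

/-- **K3 · FLUX-WEIGHTED STRETCHING-CLOCK LAW (the card's new object; size L).** Same hypotheses;
conclusion strengthened from "sup over x" to "mean against an adjoint flux density": for every
window there is a NONZERO adjoint test field `η` on `[t₀, t₁]` (the backward-transported flux
density of the core vorticity at `t₁`) such that the `|η|`-weighted space mean of `λ₁⁺`,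
integrated over the window, is at least `log(t₀/t₁) − K`. (K1 + K1′ + the hull vorticity-intensity
floor; the division is by a positive quantity — adjoint backward uniqueness.) -/
def FluxWeightedStretchingLaw : Prop :=
  ∀ (C : ℝ) (u : ℝ → E3 → E3) (p : ℝ → E3 → ℝ) (G : ℝ → E3 → E3 →L[ℝ] E3) (q : ℝ → E3 → ℝ),
    InCruxClass C u p G → IsClassicalNSSolutionOn (Iio 0) 1 0 u q →
    IsScalingUniformlyRecurrent u → IsBackwardSingularPoint u 0 →
      ∃ K : ℝ, ∀ (t₀ t₁ : ℝ), t₀ < t₁ → t₁ < 0 →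
        ∃ η : ℝ → E3 → E3, IsAdjointVorticityTestField (Icc t₀ t₁) u η ∧
          (∀ t ∈ Icc t₀ t₁, 0 < ∫ x, ‖η t x‖) ∧
          Real.log (t₀ / t₁) - K ≤
            ∫ t in t₀..t₁, (∫ x, max (topStrain u t x) 0 * ‖η t x‖) / (∫ x, ‖η t x‖)

/-- **K4 · THE BET (research stub; the only open one).** A STRAIN BUDGET from the other side: on the
crux's class the flux-weighted window mean of `(−t)λ₁⁺` is eventually `< 1` — i.e. no profile can
keep the clock. Stated as the negation of K3's conclusion for singular profiles, which together
with K3 closes the crux; NOT claimed easier than the crux in general (see the card's `Transfer`). -/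
def FluxStarvation : Prop :=
  ∀ (C : ℝ) (u : ℝ → E3 → E3) (p : ℝ → E3 → ℝ) (G : ℝ → E3 → E3 →L[ℝ] E3) (q : ℝ → E3 → ℝ),
    InCruxClass C u p G → IsClassicalNSSolutionOn (Iio 0) 1 0 u q →
    IsScalingUniformlyRecurrent u → IsBackwardSingularPoint u 0 →
      ∀ K : ℝ, ∃ (t₀ t₁ : ℝ), t₀ < t₁ ∧ t₁ < 0 ∧
        ∀ η : ℝ → E3 → E3, IsAdjointVorticityTestField (Icc t₀ t₁) u η →
          (∀ t ∈ Icc t₀ t₁, 0 < ∫ x, ‖η t x‖) →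
          ∫ t in t₀..t₁, (∫ x, max (topStrain u t x) 0 * ‖η t x‖) / (∫ x, ‖η t x‖)
            < Real.log (t₀ / t₁) - K

/-- Pure logic: the flux-weighted law and flux starvation are contradictory on singular recurrent
class profiles with an interior classical representative — the shape in which the card's line
would conclude (the representative is the support item `SmoothRepresentative` of route
DulacContraction / A–B Thm 1.1, not re-typed here). -/
theorem no_singular_of_law_and_starvation (hK3 : FluxWeightedStretchingLaw) (hK4 : FluxStarvation)
    (C : ℝ) (u : ℝ → E3 → E3) (p : ℝ → E3 → ℝ) (G : ℝ → E3 → E3 →L[ℝ] E3) (q : ℝ → E3 → ℝ)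
    (hcl : InCruxClass C u p G) (hq : IsClassicalNSSolutionOn (Iio 0) 1 0 u q)
    (hrec : IsScalingUniformlyRecurrent u) : ¬ IsBackwardSingularPoint u 0 := by
  intro hsing
  obtain ⟨K, hK⟩ := hK3 C u p G q hcl hq hrec hsing
  obtain ⟨t₀, t₁, h01, h1, hstarve⟩ := hK4 C u p G q hcl hq hrec hsing K
  obtain ⟨η, hη, hpos, hlaw⟩ := hK t₀ t₁ h01 h1
  exact absurd hlaw (not_le.mpr (hstarve η hη hpos))

end Summit.NavierStokesRegularity.NavierStokesRegularity.Cruxes.RecurrentLiouville.StretchingClock
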